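import Literature.Topology.FourManifolds.NormalPositionGeometry
import Literature.Topology.FourManifolds.KnotsProofs
import HarnessLib

/-!
# The reflection of `𝕊³` in the last coordinate, read in the chart `ψ`: an inversion

Topic `Literature/Topology/FourManifolds` (trunk T-4MAN). Fact seat
`provefact-Literature.Topology.FourManifolds.Knot.IsConnectedSum.isIsotopic` (Schubert's theorem),
geometric heart for rail knots, transport step: the southern constructions are moved to the
north by the reflection `reflectLast 3 : (x₀, x₁, x₂, x₃) ↦ (x₀, x₁, x₂, -x₃)` of `𝕊³` (tree:
`Knots.lean`, `reflectLastDiffeo`, `KnotsProofs.lean`), which exchanges the open hemispheres and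
fixes the equator pointwise. In the stereographic chart `ψ` from the north pole
(`NormalPositionGeometry.psiN`) the reflection is the **inversion in the sphere of radius `2`**,
`sphereInv y = (4 / ‖y‖²) y` (Mathlib's `EuclideanGeometry.inversion 0 2`, `sphereInv_eq_inversion`;
the API below is derived from Mathlib's):

* `psiN_reflectLast : ψ (reflectLast 3 x) = sphereInv (ψ x)` for `x` other than the two poles:
  the specialisation `v = northPole` of the tree's inversion formula
  `poleReflection_stereographic'_symm` (`PalaisBallComplement.lean`) through the bridge
  `coe_reflectLast_eq_poleReflection : R x = poleReflection northPole x`;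
* `sphereInv` is an involution off `0`, `‖sphereInv y‖ = 4/‖y‖`, it fixes the sphere of radius `2`,
  is `C^∞` off `0`, and at a point `p` with `‖p‖ = 2` its derivative is the reflection
  `h ↦ h - (⟪p, h⟫/2) p` in the hyperplane `p^⊥` (`hasFDerivAt_sphereInv_of_norm_eq_two`).
* hemispheres: `reflectLast 3` maps `InNorth` knots to `InSouth` knots and conversely
  (`SphereEmbedding.InNorth.map_reflectLast`, `InSouth.map_reflectLast`), and preserves the
  equator (`reflectLast_mem_sphereEquator_iff`).

Everything is proved; no named facts are introduced.

## References

* J. M. Lee, *Introduction to Smooth Manifolds*, 2nd ed. (2012), Example 1.4 and Problem 1-7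
  (stereographic coordinates; the transition between the two stereographic charts is the
  inversion `u ↦ u/‖u‖²` up to scale). [LeeSmoothManifolds2013]
-/

open scoped Manifold ContDiff Topology Real RealInnerProductSpace
open Function Set Metric Filter

noncomputable section

namespace Literature.Topology.FourManifolds

/-- Local notation: `𝔼 n` is the model Euclidean space `EuclideanSpace ℝ (Fin n)`. -/
local notation "𝔼 " n:arg => EuclideanSpace ℝ (Fin n)

/-- Local notation: `𝕊 n` is the unit sphere in `EuclideanSpace ℝ (Fin (n + 1))`. -/
local notation "𝕊 " n:arg => (Metric.sphere (0 : EuclideanSpace ℝ (Fin (n + 1))) 1)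

attribute [local instance] fact_finrank_euclideanSpace_succ

open KnotsInBall

/-! ### The inversion in the sphere of radius `2` -/

/-- **The inversion** `y ↦ (4/‖y‖²) y` of `ℝ³` in the sphere of radius `2` (explicit form of
Mathlib's `EuclideanGeometry.inversion 0 2`). [folklore] -/
def sphereInv (y : 𝔼 3) : 𝔼 3 := (4 / ‖y‖ ^ 2) • y

/-- `sphereInv` is Mathlib's inversion with centre `0` and radius `2`. [folklore] -/
theorem sphereInv_eq_inversion : sphereInv = EuclideanGeometry.inversion (0 : 𝔼 3) 2 := by
  funext y
  simp only [sphereInv, EuclideanGeometry.inversion, dist_zero_right, vsub_eq_sub, sub_zero, vadd_eq_add, add_zero, div_pow]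
  norm_num

/-- The norm of the inverted point: `4/‖y‖`. [folklore] -/
theorem norm_sphereInv (y : 𝔼 3) : ‖sphereInv y‖ = 4 / ‖y‖ := by
  rw [sphereInv_eq_inversion, ← dist_zero_right, EuclideanGeometry.dist_inversion_center, dist_zero_right]; norm_num

/-- The inversion fixes the sphere of radius `2` pointwise. [folklore] -/
theorem sphereInv_of_norm_eq_two {y : 𝔼 3} (hy : ‖y‖ = 2) : sphereInv y = y := by
  rw [sphereInv_eq_inversion]; exact EuclideanGeometry.inversion_of_mem_sphere (by rwa [mem_sphere_zero_iff_norm])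

/-- The inversion is an involution. [folklore] -/
theorem sphereInv_sphereInv (y : 𝔼 3) : sphereInv (sphereInv y) = y := by
  rw [sphereInv_eq_inversion]; exact EuclideanGeometry.inversion_inversion 0 two_ne_zero y

/-- The inversion is `C^∞` off `0`. [folklore] -/
theorem contDiffAt_sphereInv {y : 𝔼 3} (hy : y ≠ 0) : ContDiffAt ℝ ∞ sphereInv y := by
  rw [sphereInv_eq_inversion]
  exact (contDiffAt_const.inversion contDiffAt_const contDiffAt_id hy :)

/-- **The derivative of the inversion at a point of the sphere of radius `2`** is the reflection in
the hyperplane orthogonal to the point: `h ↦ h - (⟪p, h⟫/2) p` (Mathlib: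
`EuclideanGeometry.hasFDerivAt_inversion`). [folklore] -/
theorem hasFDerivAt_sphereInv_of_norm_eq_two {p : 𝔼 3} (hp : ‖p‖ = 2) :
    HasFDerivAt sphereInv (ContinuousLinearMap.id ℝ (𝔼 3) - (1 / 2 : ℝ) • ((innerSL ℝ p).smulRight p)) p := by
  have hp0 : p ≠ 0 := by rw [← norm_pos_iff, hp]; norm_num
  have h := EuclideanGeometry.hasFDerivAt_inversion (c := (0 : 𝔼 3)) (R := 2) hp0
  rw [sphereInv_eq_inversion]
  refine h.congr_fderiv (ContinuousLinearMap.ext fun v ↦ ?_)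
  rw [dist_zero_right, hp, sub_zero]
  change ((2 : ℝ) / 2) ^ 2 • ((ℝ ∙ p)ᗮ.reflection v) = _
  rw [Submodule.reflection_apply, Submodule.starProjection_orthogonal_val, Submodule.starProjection_singleton]
  simp [ContinuousLinearMap.smulRight_apply, hp, smul_smul]
  norm_num
  module

/-! ### The reflection in coordinates -/

/-- The reflected point differs from the point by a multiple of the north pole:
`R x = x - 2 x₃ • northPole`. [folklore] -/
theorem coe_reflectLast_eq_sub (x : 𝕊 3) :
    ((reflectLast 3 x : 𝕊 3) : 𝔼 4) = (x : 𝔼 4) - (2 * (x : 𝔼 4) (Fin.last 3)) • ((northPole : 𝕊 3) : 𝔼 4) := by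
  ext i
  rw [PiLp.sub_apply, PiLp.smul_apply, coe_northPole]
  by_cases hi : i = Fin.last 3
  · subst hi; rw [reflectLast_apply_last]; simp; ring
  · rw [reflectLast_apply_of_ne_last 3 x hi]
    have hi3 : i ≠ 3 := fun h ↦ hi (by rw [h]; rfl)
    have hi' : (EuclideanSpace.single (Fin.last 3) (1 : ℝ) : 𝔼 4) i = 0 := by simp [hi3]
    rw [hi']; simp

/-! ### Hemispheres and the equator under the reflection -/

/-- The reflection maps the open northern hemisphere to the open southern one. [folklore] -/
theorem SphereEmbedding.InNorth.map_reflectLast {k : ℕ} {K : SphereEmbedding k 3} (h : K.InNorth) :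
    (K.map (reflectLastDiffeo 3)).InSouth := fun x ↦ by
  rw [SphereEmbedding.map_apply, coe_reflectLastDiffeo, reflectLast_apply_last]
  linarith [h x]

/-- The reflection maps the open southern hemisphere to the open northern one. [folklore] -/
theorem SphereEmbedding.InSouth.map_reflectLast {k : ℕ} {K : SphereEmbedding k 3} (h : K.InSouth) :
    (K.map (reflectLastDiffeo 3)).InNorth := fun x ↦ by
  rw [SphereEmbedding.map_apply, coe_reflectLastDiffeo, reflectLast_apply_last]
  linarith [h x]

/-- The reflection preserves the equator. [folklore] -/
theorem reflectLast_mem_sphereEquator_iff (x : 𝕊 3) : reflectLast 3 x ∈ sphereEquator 2 ↔ x ∈ sphereEquator 2 := by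
  rw [mem_sphereEquator_iff, mem_sphereEquator_iff, reflectLast_apply_last, neg_eq_zero]

/-- The preimage of the equator under the reflection is the equator. [folklore] -/
theorem reflectLast_preimage_sphereEquator : reflectLast 3 ⁻¹' sphereEquator 2 = sphereEquator 2 := by
  ext x; exact reflectLast_mem_sphereEquator_iff x

/-- A point reflects to the north pole iff it is the south pole. [folklore] -/
theorem reflectLast_eq_northPole_iff (x : 𝕊 3) : reflectLast 3 x = northPole ↔ x = southPole := by
  constructor
  · intro h
    have := congrArg (reflectLast 3) h
    rw [reflectLast_reflectLast] at this
    rw [this]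
    apply Subtype.ext
    rw [coe_reflectLast_eq_sub, northPole_apply_last, coe_southPole, coe_northPole]
    module
  · intro h
    rw [h]
    apply Subtype.ext
    rw [coe_reflectLast_eq_sub, southPole_apply_last, coe_southPole, coe_northPole]
    module

/-! ### The reflection in the chart -/

/-- **Bridge to the tree's pole reflection**: `reflectLast 3` is the reflection of `ℝ⁴` in the
hyperplane orthogonal to the north pole (`poleReflection`, `PalaisBallComplement.lean`). [folklore] -/
theorem coe_reflectLast_eq_poleReflection (x : 𝕊 3) :
    ((reflectLast 3 x : 𝕊 3) : 𝔼 4) = poleReflection (northPole : 𝕊 3) (x : 𝔼 4) := by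
  rw [coe_reflectLast_eq_sub, poleReflection, Submodule.reflection_apply, Submodule.starProjection_orthogonal_val,
    Submodule.starProjection_singleton, inner_northPole, norm_eq_of_mem_sphere northPole]
  simp
  module

/-- `ψ x = 0` only at the south pole. [folklore] -/
theorem psiN_ne_zero {x : 𝕊 3} (hN : x ≠ northPole) (hS : x ≠ southPole) : psiN x ≠ 0 := by
  intro h0
  apply hS
  have h1 : x = psiN.symm 0 := by rw [← h0, psiN_symm_apply_psiN hN]
  apply Subtype.ext
  rw [h1, psiN, coe_stereographic'_symm_zero, coe_southPole, coe_northPole]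

/-- **The reflection in the chart is the inversion**: `ψ (reflectLast 3 x) = (4/‖ψ x‖²) ψ x` for `x`
other than the two poles — the case `v = northPole` of the tree's inversion formula
`poleReflection_stereographic'_symm`. [cite: LeeSmoothManifolds2013, Problem 1-7] -/
theorem psiN_reflectLast {x : 𝕊 3} (hN : x ≠ northPole) (hS : reflectLast 3 x ≠ northPole) :
    psiN (reflectLast 3 x) = sphereInv (psiN x) := by
  have hS' : x ≠ southPole := fun h ↦ hS ((reflectLast_eq_northPole_iff x).2 h)
  have hz : psiN x ≠ 0 := psiN_ne_zero hN hS'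
  have h1 : ((reflectLast 3 x : 𝕊 3) : 𝔼 4) = ((psiN.symm (sphereInv (psiN x)) : 𝕊 3) : 𝔼 4) := by
    have h := poleReflection_stereographic'_symm (n := 3) (northPole : 𝕊 3) hz
    rw [coe_reflectLast_eq_poleReflection, sphereInv]
    rw [← psiN, psiN_symm_apply_psiN hN] at h
    exact h
  rw [Subtype.ext h1, psiN_apply_psiN_symm]

end Literature.Topology.FourManifolds
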